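import Summits.QuantumFields.YangMills.Theorems.BalabanUVNodesN21CollarJunctionProjectedCentre

/-!
# N21 (NE7c) · THE COLLAR JUNCTIONS WITH THE PER-LETTER IMAGE CLAUSES DISCHARGED BY SPECIES: kept two-sided letters
# relaxed, dropped `≥`-cuts lowered, from ONE bound on the centre's collar coordinates

R141 (C) seat pub-ymgap-dag-n21-e (g17), node N21 = NE7c (single-run shell-weight bound, NOT PRINTED in [Bałaban
1983–89], NOT proved), strategy s3 ALTERNATIVE CURRENCY, lane K3⁷ `SpineGivenEndpointR13SepCoPH`
(stmt-QuantumFields-20544, `--kind proof --supports … --as helper`).  Part 38q of this seat's series; successor of 38m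
`…N21CollarJunctionLowCentre` (p579137) and 38n `…N21CollarJunctionProjectedCentre` (p582388); item (w-b) of the g16
HANDOFF's open list (plan `W-SEAT-START-LIST.md` v4 §n21 item 4), unowned after the D-0149 w-seat claims.

WHY.  After 38m ∕ 38n the re-centred END P2 stands on both of n21-d's roads with `hmono`, `hQ` and `henv` discharged,
`henv` through the LETTERWISE split of 38m §2: per-letter image clauses `hletter` (every support letter `P₁ i` is
carried into its envelope letter `E₁ i` by the contraction `w ↦ c + l(w − c)`, `l ∈ [l₀, 1]`) + a core clause.  38m §2
already proves the two SPECIES of image clause from ONE located input — a bound `|c_z i| ≤ M_i` on the centre's collar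
coordinates (lens Card 82 ∕ part 30 §B's numbers): kept two-sided letters `(−θₑ, θₑ) ↦ (−θₑ′, θₑ′)`,
`θₑ′ = θₑ + (1−l₀)(θₑ + M_i)` (`letterImage_abs_mem_Ioo`), and dropped `≥`-cuts `[b, ∞) ↦ [b − (1−l₀)(|b| + M_i), ∞)`
(`letterImage_geCut_mem_Ici`).  This file assembles them for a MIXED collar — a species assignment `i ∈ Mabs` (kept
two-sided letter) or not (dropped `≥`-cut) on the collar index set `M` — and removes `hletter`, `hP₁`, `hE₁`, `hPE`
from both ★★★ ENDs:
* §1 (species bookkeeping; the letters are DISPLAYED EQUATIONS `hP` ∕ `hE` on `P₁` ∕ `E₁`, so consumers instantiate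
  by `rfl`) `measurableSet_of_species`, `subset_of_species` (`P₁ i ⊆ E₁ i`), ★ `hletter_of_species`;
* §2 ★★★★ `slotAntiConcentration_restrict_of_lowCentre_species` (38m ★★★ with the image clauses discharged; binders
  left: the low-centre inequality `hlow`, radial transversality `hRT`, the core clause `hcore`, the species odds
  `hodds`, and the ONE located letter `hMm : |m z i| ≤ M_i`) and ★★★★
  `slotAntiConcentration_restrict_of_projectedCentre_species` (38n ★★★ likewise, about the dilation centre `c`);
* §3 A6 `collarJunctionSpecies_binders_inhabited` — §2's projected-centre END APPLIED with every binder discharged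
  (38n §2's one-point witness with the collar in species form: letter `(−½, ½)` on coordinate `0`, `M₀ = 0`,
  envelope `(−⅔, ⅔)`; slopes `gaussianBlock_inwardSlopes_half`).
HONEST FRAMING.  [textbook] composition + real arithmetic; 0 def, 0 sorry; the centre bound `M_i`, the letters, the
odds `Qᵢ` (at the RELAXED letters), coercivity ∕ Lipschitz ∕ obtuseness ∕ farness ∕ transversality and the not-read
structure are HYPOTHESES (n21-d parts 19 ∕ 27 ∕ 30 ∕ 32, NODE O's term object, lens Cards 80–88 — none asserted);
nothing of Bałaban's asserted; NE7c NOT PRINTED ∕ NOT proved; N21 NOT discharged; counts unmoved (typed 28∕28 ·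
discharged 5∕27); count-neutral; one finite 𝕋⁴ at fixed ε — nothing about ℝ⁴ ∕ OS ∕ mass gap ∕ Clay.
-/

set_option autoImplicit false

open MeasureTheory Set Function Matrix
open scoped ENNReal

namespace Summit.QuantumFields.YangMills.Theorems.N21CollarJunctionLetterSpecies

open Literature.MathematicalPhysics.QuantumFieldTheory.Balaban1983to89.T4ShellMeasure (SlotAntiConcentration)
open Summit.QuantumFields.YangMills.Theorems.N21CollarOddsBlockFrame (isFiniteMeasure_blockGaussianWeight)
open Summit.QuantumFields.YangMills.Theorems.N21CollarLetterOdds (gaussianBlock_update_diff)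
open Summit.QuantumFields.YangMills.Theorems.N21CollarEnvelopeOdds (hodds_absLetter_of_partialSlopes)
open Summit.QuantumFields.YangMills.Theorems.N21CollarJunctionLowCentre
  (letterImage_abs_mem_Ioo letterImage_geCut_mem_Ici slotAntiConcentration_restrict_of_lowCentre_letterwise
    measurable_fibreIndicator withDensity_fibreIndicator_eq_restrict condOdds_keptCuts hcore_of_starConvex)
open Summit.QuantumFields.YangMills.Theorems.N21CollarJunctionProjectedCentre
  (slotAntiConcentration_restrict_of_projectedCentre_letterwise quadForm_one_eq_gaussian sup_sq_le_two_dot)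

variable {X : Type*} [MeasurableSpace X] {κ : Type*} [Fintype κ] [DecidableEq κ]

/-! ## §1 Species bookkeeping: kept two-sided letters and dropped `≥`-cuts on one collar -/

section Species

omit [MeasurableSpace X] [Fintype κ] in
/-- both species of letter are measurable. [bookkeeping] -/
theorem measurableSet_of_species (M Mabs : Finset κ) (u v b : κ → ℝ) (P₁ : κ → Set ℝ)
    (hP : ∀ i ∈ M, P₁ i = if i ∈ Mabs then Ioo (u i) (v i) else Ici (b i)) :
    ∀ i ∈ M, MeasurableSet (P₁ i) := by
  intro i hi
  rw [hP i hi]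
  split_ifs
  · exact measurableSet_Ioo
  · exact measurableSet_Ici

omit [MeasurableSpace X] [Fintype κ] in
/-- every support letter lies in its relaxed envelope letter (`l₀ ≤ 1`, `θₑ ≥ 0`, `M_i ≥ 0`). [bookkeeping] -/
theorem subset_of_species (M Mabs : Finset κ) (θe b Mb : κ → ℝ) (P₁ E₁ : κ → Set ℝ) {l₀ : ℝ} (hl₀1 : l₀ ≤ 1)
    (hθe : ∀ i, 0 ≤ θe i) (hMb : ∀ i, 0 ≤ Mb i)
    (hP : ∀ i ∈ M, P₁ i = if i ∈ Mabs then Ioo (-θe i) (θe i) else Ici (b i))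
    (hE : ∀ i ∈ M, E₁ i = if i ∈ Mabs then Ioo (-(θe i + (1 - l₀) * (θe i + Mb i))) (θe i + (1 - l₀) * (θe i + Mb i))
      else Ici (b i - (1 - l₀) * (|b i| + Mb i))) :
    ∀ i ∈ M, P₁ i ⊆ E₁ i := by
  intro i hi
  rw [hP i hi, hE i hi]
  have h1 : 0 ≤ 1 - l₀ := by linarith
  split_ifs
  · have : 0 ≤ (1 - l₀) * (θe i + Mb i) := mul_nonneg h1 (add_nonneg (hθe i) (hMb i))
    exact Ioo_subset_Ioo (by linarith) (by linarith)
  · have : 0 ≤ (1 - l₀) * (|b i| + Mb i) := mul_nonneg h1 (add_nonneg (abs_nonneg _) (hMb i))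
    exact Ici_subset_Ici.2 (by linarith)

omit [MeasurableSpace X] [Fintype κ] in
/-- ★ **THE PER-LETTER IMAGE CLAUSES FROM ONE BOUND ON THE CENTRE'S COLLAR COORDINATES.**  `|c_z i| ≤ M_i` for every
exterior point and collar index; species: `i ∈ Mabs` a kept two-sided letter `(−θₑ, θₑ)` with envelope
`(−θₑ′, θₑ′)`, `θₑ′ = θₑ + (1−l₀)(θₑ + M_i)`; otherwise a dropped `≥`-cut `[b, ∞)` with envelope
`[b − (1−l₀)(|b| + M_i), ∞)` (`0 ≤ l₀`).  Then the contraction toward the centre carries every support letter into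
its envelope letter — 38m §2's two lemmas BY NAME. [textbook] -/
theorem hletter_of_species (c : X → (κ → ℝ)) (M Mabs : Finset κ) (θe b Mb : κ → ℝ) (P₁ E₁ : κ → Set ℝ)
    {l₀ : ℝ} (hl₀0 : 0 ≤ l₀) (hMc : ∀ z i, |c z i| ≤ Mb i)
    (hP : ∀ i ∈ M, P₁ i = if i ∈ Mabs then Ioo (-θe i) (θe i) else Ici (b i))
    (hE : ∀ i ∈ M, E₁ i = if i ∈ Mabs then Ioo (-(θe i + (1 - l₀) * (θe i + Mb i))) (θe i + (1 - l₀) * (θe i + Mb i))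
      else Ici (b i - (1 - l₀) * (|b i| + Mb i))) :
    ∀ i ∈ M, ∀ l ∈ Icc l₀ 1, ∀ (z : X) (w : κ → ℝ), w i ∈ P₁ i → (c z + l • (w - c z)) i ∈ E₁ i := by
  intro i hi l hl z w hin
  rw [hP i hi] at hin
  rw [hE i hi]
  by_cases hmem : i ∈ Mabs
  · rw [if_pos hmem] at hin ⊢
    exact letterImage_abs_mem_Ioo i c hl.1 hl.2 (fun z => hMc z i) z w hin
  · rw [if_neg hmem] at hin ⊢
    exact letterImage_geCut_mem_Ici i c (hl₀0.trans hl.1) hl.1 hl.2 (fun z => hMc z i) z w hin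

omit [MeasurableSpace X] [DecidableEq κ] in
/-- the road's contraction ratio `l₀ = 1 − 1∕(#κ+1)` lies in `[0, 1]`. [bookkeeping] -/
theorem l₀_mem_Icc : (1 - 1 / ((Fintype.card κ : ℝ) + 1)) ∈ Icc (0 : ℝ) 1 := by
  have h0 : (0 : ℝ) ≤ (Fintype.card κ : ℝ) := by positivity
  have h1 : 1 / ((Fintype.card κ : ℝ) + 1) ≤ 1 := by
    rw [div_le_one (by positivity)]
    linarith
  have h2 : 0 ≤ 1 / ((Fintype.card κ : ℝ) + 1) := by positivity
  exact ⟨by linarith, by linarith⟩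

end Species

/-! ## §2 The junctions with the image clauses discharged by species -/

section Junction

/-- ★★★★ **THE LOW-CENTRE JUNCTION, IMAGE CLAUSES DISCHARGED.**  38m ★★★
`slotAntiConcentration_restrict_of_lowCentre_letterwise` with the collar's letters given by SPECIES (`hP` ∕ `hE`,
displayed equations) and `hletter` ∕ `hP₁` ∕ `hE₁` ∕ `hPE` supplied by §1 from the ONE located letter
`hMm : |m z i| ≤ M_i`.  Binders left: the low-centre inequality `hlow`, radial transversality `hRT`, the core clause
`hcore`, the species odds `hodds` at the relaxed letters. [textbook] -/
theorem slotAntiConcentration_restrict_of_lowCentre_species [Nonempty κ] (ζ : Measure X) [SFinite ζ]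
    {m : X → (κ → ℝ)} (hm : Measurable m) (K : X → Set (κ → ℝ)) (φ : X → (κ → ℝ) → ℝ)
    (hg : Measurable fun p : X × (κ → ℝ) =>
      (K p.1).indicator (fun w => ENNReal.ofReal (Real.exp (-φ p.1 w))) p.2)
    [IsFiniteMeasure ((ζ.prod volume).withDensity fun p : X × (κ → ℝ) =>
      (K p.1).indicator (fun w => ENNReal.ofReal (Real.exp (-φ p.1 w))) p.2)]
    {U : X × (κ → ℝ) → ℝ} (hUm : Measurable U)
    {Cstar : Set (X × (κ → ℝ))} (hCstar : MeasurableSet Cstar)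
    (M Mabs : Finset κ) (θe b Mb : κ → ℝ) (hθe : ∀ i, 0 ≤ θe i) (hMb : ∀ i, 0 ≤ Mb i)
    (hMm : ∀ z i, |m z i| ≤ Mb i) (P₁ E₁ : κ → Set ℝ)
    (hP : ∀ i ∈ M, P₁ i = if i ∈ Mabs then Ioo (-θe i) (θe i) else Ici (b i))
    (hE : ∀ i ∈ M, E₁ i = if i ∈ Mabs
      then Ioo (-(θe i + (1 - (1 - 1 / ((Fintype.card κ : ℝ) + 1))) * (θe i + Mb i)))
        (θe i + (1 - (1 - 1 / ((Fintype.card κ : ℝ) + 1))) * (θe i + Mb i))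
      else Ici (b i - (1 - (1 - 1 / ((Fintype.card κ : ℝ) + 1))) * (|b i| + Mb i)))
    (Q : κ → ℝ) (hQ0 : ∀ i ∈ M, 0 ≤ Q i)
    (hodds : ∀ i ∈ M, ∀ C : Set (X × (κ → ℝ)), MeasurableSet C →
      (∀ (z : X) (w : κ → ℝ) (y : ℝ), (z, update w i y) ∈ C ↔ (z, w) ∈ C) →
      ((ζ.prod volume).withDensity fun p : X × (κ → ℝ) =>
          (K p.1).indicator (fun w => ENNReal.ofReal (Real.exp (-φ p.1 w))) p.2)
          (({q | q.2 i ∈ E₁ i} \ {q | q.2 i ∈ P₁ i}) ∩ C)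
        ≤ ENNReal.ofReal (Q i) *
          ((ζ.prod volume).withDensity fun p : X × (κ → ℝ) =>
            (K p.1).indicator (fun w => ENNReal.ofReal (Real.exp (-φ p.1 w))) p.2) ({q | q.2 i ∈ P₁ i} ∩ C))
    (hUi : ∀ i ∈ M, ∀ (z : X) (w : κ → ℝ) (y : ℝ), U (z, update w i y) = U (z, w))
    (hCi : ∀ i ∈ M, ∀ (z : X) (w : κ → ℝ) (y : ℝ), (z, update w i y) ∈ Cstar ↔ (z, w) ∈ Cstar)
    {θ ρ κ₀ : ℝ} (hθ : 0 < θ) (hρ0 : 0 < ρ) (hρ1 : ρ < 1) (hκ : 0 < κ₀)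
    (hK : ∀ z, Convex ℝ (K z)) (hφ : ∀ z, ConvexOn ℝ (K z) (φ z)) (hmK : ∀ z, m z ∈ K z)
    (hlow : ∀ p : X × (κ → ℝ), θ * (1 - ρ) ≤ U p → U p < θ →
      p ∈ Cstar ∩ ⋂ i ∈ M, {q : X × (κ → ℝ) | q.2 i ∈ P₁ i} → p.2 ∈ K p.1 →
        φ p.1 (m p.1) ≤ φ p.1 (m p.1 + (1 - 1 / ((Fintype.card κ : ℝ) + 1)) • (p.2 - m p.1)))
    (hcore : ∀ l ∈ Icc (1 - 1 / ((Fintype.card κ : ℝ) + 1)) 1, ∀ p : X × (κ → ℝ),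
      θ * (1 - ρ) ≤ U p → U p < θ → p ∈ Cstar →
        (p.1, m p.1 + l • (p.2 - m p.1)) ∈ {q : X × (κ → ℝ) | U q < θ} ∩ Cstar)
    (hRT : ∀ p : X × (κ → ℝ), θ * (1 - ρ) ≤ U p → U p < θ →
      p ∈ Cstar ∩ ⋂ i ∈ M, {q : X × (κ → ℝ) | q.2 i ∈ P₁ i} → ∀ s : ℝ, 1 ≤ s →
      θ * (1 - ρ) ≤ U (p.1, m p.1 + s • (p.2 - m p.1)) → U (p.1, m p.1 + s • (p.2 - m p.1)) < θ →
        (p.1, m p.1 + s • (p.2 - m p.1)) ∈ Cstar ∩ ⋂ i ∈ M, {q : X × (κ → ℝ) | q.2 i ∈ P₁ i} →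
          U p + κ₀ * (θ * (1 - ρ)) * (s - 1) ≤ U (p.1, m p.1 + s • (p.2 - m p.1))) :
    SlotAntiConcentration
      (((ζ.prod volume).withDensity fun p : X × (κ → ℝ) =>
          (K p.1).indicator (fun w => ENNReal.ofReal (Real.exp (-φ p.1 w))) p.2).restrict
        ({p | U p < θ} ∩ (Cstar ∩ ⋂ i ∈ M, {q : X × (κ → ℝ) | q.2 i ∈ P₁ i}))) U θ ρ
      (3 * ((Fintype.card κ : ℝ) + 1) * (∏ i ∈ M, (1 + Q i)) / (κ₀ * (1 - ρ))) := by
  have hl := (l₀_mem_Icc (κ := κ))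
  exact slotAntiConcentration_restrict_of_lowCentre_letterwise ζ hm K φ hg hUm hCstar M P₁ E₁
    (measurableSet_of_species M Mabs (fun i => -θe i) θe b P₁ hP)
    (measurableSet_of_species M Mabs _ _ _ E₁ hE) (subset_of_species M Mabs θe b Mb P₁ E₁ hl.2 hθe hMb hP hE)
    Q hQ0 hodds hUi hCi hθ hρ0 hρ1 hκ hK hφ hmK hlow (hletter_of_species m M Mabs θe b Mb P₁ E₁ hl.1 hMm hP hE)
    hcore hRT

/-- ★★★★ **THE PROJECTED-CENTRE JUNCTION, IMAGE CLAUSES DISCHARGED.**  38n ★★★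
`slotAntiConcentration_restrict_of_projectedCentre_letterwise` with the collar's letters given by species and the
image clauses about the dilation centre `c` supplied by §1 from `hMc : |c_z i| ≤ M_i`.  Binders left: obtuseness
`hobt`, farness `hfar`, radial transversality `hRT`, the core clause `hcore`, the species odds `hodds`. [textbook] -/
theorem slotAntiConcentration_restrict_of_projectedCentre_species [Nonempty κ] (ζ : Measure X) [SFinite ζ]
    (K : X → Set (κ → ℝ)) (A : Matrix κ κ ℝ) (hA : A.IsSymm) {γ G : ℝ} (hγ0 : 0 < γ)
    (hγ : ∀ x : κ → ℝ, γ * ‖x‖ ^ 2 ≤ x ⬝ᵥ (A *ᵥ x))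
    (m : X → (κ → ℝ)) {c : X → (κ → ℝ)} (hc : Measurable c) (P : X → (κ → ℝ) → ℝ)
    (hg : Measurable fun p : X × (κ → ℝ) => (K p.1).indicator (fun w => ENNReal.ofReal (Real.exp
      (-(1 / 2 * ((w - m p.1) ⬝ᵥ (A *ᵥ (w - m p.1))) + P p.1 w)))) p.2)
    [IsFiniteMeasure ((ζ.prod volume).withDensity fun p : X × (κ → ℝ) => (K p.1).indicator (fun w =>
      ENNReal.ofReal (Real.exp (-(1 / 2 * ((w - m p.1) ⬝ᵥ (A *ᵥ (w - m p.1))) + P p.1 w)))) p.2)]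
    {U : X × (κ → ℝ) → ℝ} (hUm : Measurable U)
    {Cstar : Set (X × (κ → ℝ))} (hCstar : MeasurableSet Cstar)
    (M Mabs : Finset κ) (θe b Mb : κ → ℝ) (hθe : ∀ i, 0 ≤ θe i) (hMb : ∀ i, 0 ≤ Mb i)
    (hMc : ∀ z i, |c z i| ≤ Mb i) (P₁ E₁ : κ → Set ℝ)
    (hP : ∀ i ∈ M, P₁ i = if i ∈ Mabs then Ioo (-θe i) (θe i) else Ici (b i))
    (hE : ∀ i ∈ M, E₁ i = if i ∈ Mabs
      then Ioo (-(θe i + (1 - (1 - 1 / ((Fintype.card κ : ℝ) + 1))) * (θe i + Mb i)))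
        (θe i + (1 - (1 - 1 / ((Fintype.card κ : ℝ) + 1))) * (θe i + Mb i))
      else Ici (b i - (1 - (1 - 1 / ((Fintype.card κ : ℝ) + 1))) * (|b i| + Mb i)))
    (Q : κ → ℝ) (hQ0 : ∀ i ∈ M, 0 ≤ Q i)
    (hodds : ∀ i ∈ M, ∀ C : Set (X × (κ → ℝ)), MeasurableSet C →
      (∀ (z : X) (w : κ → ℝ) (y : ℝ), (z, update w i y) ∈ C ↔ (z, w) ∈ C) →
      ((ζ.prod volume).withDensity fun p : X × (κ → ℝ) => (K p.1).indicator (fun w => ENNReal.ofReal (Real.exp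
          (-(1 / 2 * ((w - m p.1) ⬝ᵥ (A *ᵥ (w - m p.1))) + P p.1 w)))) p.2)
          (({q | q.2 i ∈ E₁ i} \ {q | q.2 i ∈ P₁ i}) ∩ C)
        ≤ ENNReal.ofReal (Q i) *
          ((ζ.prod volume).withDensity fun p : X × (κ → ℝ) => (K p.1).indicator (fun w => ENNReal.ofReal (Real.exp
            (-(1 / 2 * ((w - m p.1) ⬝ᵥ (A *ᵥ (w - m p.1))) + P p.1 w)))) p.2) ({q | q.2 i ∈ P₁ i} ∩ C))
    (hUi : ∀ i ∈ M, ∀ (z : X) (w : κ → ℝ) (y : ℝ), U (z, update w i y) = U (z, w))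
    (hCi : ∀ i ∈ M, ∀ (z : X) (w : κ → ℝ) (y : ℝ), (z, update w i y) ∈ Cstar ↔ (z, w) ∈ Cstar)
    {θ ρ κ₀ : ℝ} (hθ : 0 < θ) (hρ0 : 0 < ρ) (hρ1 : ρ < 1) (hκ : 0 < κ₀)
    (hK : ∀ z, Convex ℝ (K z)) (hcK : ∀ z, c z ∈ K z)
    (hP' : ∀ z, ∀ v ∈ K z, ∀ v' ∈ K z, P z v - P z v' ≤ G * ‖v - v'‖)
    (hobt : ∀ p : X × (κ → ℝ), θ * (1 - ρ) ≤ U p → U p < θ →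
      p ∈ Cstar ∩ ⋂ i ∈ M, {q : X × (κ → ℝ) | q.2 i ∈ P₁ i} → p.2 ∈ K p.1 →
        0 ≤ (c p.1 - m p.1) ⬝ᵥ (A *ᵥ (p.2 - c p.1)))
    (hfar : ∀ p : X × (κ → ℝ), θ * (1 - ρ) ≤ U p → U p < θ →
      p ∈ Cstar ∩ ⋂ i ∈ M, {q : X × (κ → ℝ) | q.2 i ∈ P₁ i} → p.2 ∈ K p.1 → 2 * G ≤ γ * ‖p.2 - c p.1‖)
    (hcore : ∀ l ∈ Icc (1 - 1 / ((Fintype.card κ : ℝ) + 1)) 1, ∀ p : X × (κ → ℝ),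
      θ * (1 - ρ) ≤ U p → U p < θ → p ∈ Cstar →
        (p.1, c p.1 + l • (p.2 - c p.1)) ∈ {q : X × (κ → ℝ) | U q < θ} ∩ Cstar)
    (hRT : ∀ p : X × (κ → ℝ), θ * (1 - ρ) ≤ U p → U p < θ →
      p ∈ Cstar ∩ ⋂ i ∈ M, {q : X × (κ → ℝ) | q.2 i ∈ P₁ i} → ∀ s : ℝ, 1 ≤ s →
      θ * (1 - ρ) ≤ U (p.1, c p.1 + s • (p.2 - c p.1)) → U (p.1, c p.1 + s • (p.2 - c p.1)) < θ →
        (p.1, c p.1 + s • (p.2 - c p.1)) ∈ Cstar ∩ ⋂ i ∈ M, {q : X × (κ → ℝ) | q.2 i ∈ P₁ i} →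
          U p + κ₀ * (θ * (1 - ρ)) * (s - 1) ≤ U (p.1, c p.1 + s • (p.2 - c p.1))) :
    SlotAntiConcentration
      (((ζ.prod volume).withDensity fun p : X × (κ → ℝ) => (K p.1).indicator (fun w => ENNReal.ofReal (Real.exp
          (-(1 / 2 * ((w - m p.1) ⬝ᵥ (A *ᵥ (w - m p.1))) + P p.1 w)))) p.2).restrict
        ({p | U p < θ} ∩ (Cstar ∩ ⋂ i ∈ M, {q : X × (κ → ℝ) | q.2 i ∈ P₁ i}))) U θ ρ
      (3 * ((Fintype.card κ : ℝ) + 1) * (∏ i ∈ M, (1 + Q i)) / (κ₀ * (1 - ρ))) := by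
  have hl := (l₀_mem_Icc (κ := κ))
  exact slotAntiConcentration_restrict_of_projectedCentre_letterwise ζ K A hA hγ0 hγ m hc P hg hUm hCstar M P₁ E₁
    (measurableSet_of_species M Mabs (fun i => -θe i) θe b P₁ hP)
    (measurableSet_of_species M Mabs _ _ _ E₁ hE) (subset_of_species M Mabs θe b Mb P₁ E₁ hl.2 hθe hMb hP hE)
    Q hQ0 hodds hUi hCi hθ hρ0 hρ1 hκ hK hcK hP' hobt hfar
    (hletter_of_species c M Mabs θe b Mb P₁ E₁ hl.1 hMc hP hE) hcore hRT

end Junction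

/-! ## §3 A6 witness: the projected-centre END with every binder discharged, letters in species form -/

section Witness

/-- along the upper outer shell `[½, ⅔)` of the letter `{|w_i| < ½}` the Gaussian action `Σ w²∕2` does not increase
going inward within `½` (`Λ = 2`); likewise along the lower outer shell `(−⅔, −½]` (38k's `gaussianBlock_inwardSlopes`
at the species-relaxed letter `θₑ′ = θₑ + ⅓θₑ`). [textbook] -/
theorem gaussianBlock_inwardSlopes_half (i : κ) :
    (∀ (_ : Unit) (w : κ → ℝ), ∀ y₁ ∈ Ico (1 / 2 : ℝ) (2 / 3), ∀ y₂ ∈ Icc (y₁ - (2 : ℝ)⁻¹) y₁,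
      (∑ j, update w i y₂ j ^ 2 / 2) - (∑ j, update w i y₁ j ^ 2 / 2) ≤ 2 * (y₁ - y₂)) ∧
    (∀ (_ : Unit) (w : κ → ℝ), ∀ y₁ ∈ Ioc (-(2 / 3) : ℝ) (-(1 / 2)), ∀ y₂ ∈ Icc y₁ (y₁ + (2 : ℝ)⁻¹),
      (∑ j, update w i y₂ j ^ 2 / 2) - (∑ j, update w i y₁ j ^ 2 / 2) ≤ 2 * (y₂ - y₁)) := by
  refine ⟨fun _ w y₁ hy₁ y₂ hy₂ => ?_, fun _ w y₁ hy₁ y₂ hy₂ => ?_⟩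
  · rw [gaussianBlock_update_diff]
    have h1 := hy₁.1; have h3 := hy₂.1; have h4 := hy₂.2
    nlinarith
  · rw [gaussianBlock_update_diff]
    have h2 := hy₁.2; have h3 := hy₂.1; have h4 := hy₂.2
    nlinarith

/-- **A6 WITNESS OF §2's PROJECTED-CENTRE END** (director-ym STANDING A6 RULE №189 (3)): ★★★★
`slotAntiConcentration_restrict_of_projectedCentre_species` APPLIED with EVERY binder discharged in the kernel — 38n
§2's one-point witness (exterior `Unit` under `dirac ()`, block `ℝ²`, kept cut `K = {|w₁| < 1}`, `A = 1`, `P = 0`,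
`m = c = 0`, `U = |w₁|`, `θ = 1`, `ρ = ½`, `κ₀ = 1`, `C⋆ = univ`) with the collar in SPECIES FORM: ONE kept two-sided
letter on coordinate `0`, `θₑ = ½`, centre bound `M₀ = 0`, hence envelope letter `(−⅔, ⅔)` (`θₑ′ = θₑ + ⅓(θₑ + M₀)`,
`1 − l₀ = ⅓` on `ℝ²`), odds `2c∕(1−c)`, `c = e∕3` (`gaussianBlock_inwardSlopes_half`); the image clauses are NOT
supplied by hand (§1 produces them).  A satisfiability witness, not an estimate on Bałaban's measure. [textbook] -/
theorem collarJunctionSpecies_binders_inhabited :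
    SlotAntiConcentration
      ((((Measure.dirac ()).prod (volume : Measure (Fin 2 → ℝ))).withDensity
          fun p : Unit × (Fin 2 → ℝ) =>
            ({w : Fin 2 → ℝ | |w 1| < 1}).indicator (fun w => ENNReal.ofReal (Real.exp
              (-(1 / 2 * ((w - (0 : Fin 2 → ℝ)) ⬝ᵥ ((1 : Matrix (Fin 2) (Fin 2) ℝ) *ᵥ (w - 0))) + (0 : ℝ)))))
              p.2).restrict
        ({p : Unit × (Fin 2 → ℝ) | |p.2 1| < 1} ∩
          (univ ∩ ⋂ i ∈ ({0} : Finset (Fin 2)), {q : Unit × (Fin 2 → ℝ) | q.2 i ∈ Ioo (-(1 / 2) : ℝ) (1 / 2)})))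
      (fun p : Unit × (Fin 2 → ℝ) => |p.2 1|) 1 (1 / 2)
      (3 * ((Fintype.card (Fin 2) : ℝ) + 1) *
          (∏ _i ∈ ({0} : Finset (Fin 2)),
            (1 + 2 * (Real.exp 1 * 2 * ((2 : ℝ) / 3 - 1 / 2) / (1 - Real.exp 1 * 2 * ((2 : ℝ) / 3 - 1 / 2))))) /
        (1 * (1 - 1 / 2))) := by
  haveI := isFiniteMeasure_blockGaussianWeight (κ := Fin 2)
  have hdens : (fun p : Unit × (Fin 2 → ℝ) =>
      ({w : Fin 2 → ℝ | |w 1| < 1}).indicator (fun w => ENNReal.ofReal (Real.exp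
        (-(1 / 2 * ((w - (0 : Fin 2 → ℝ)) ⬝ᵥ ((1 : Matrix (Fin 2) (Fin 2) ℝ) *ᵥ (w - 0))) + (0 : ℝ))))) p.2)
      = fun p : Unit × (Fin 2 → ℝ) =>
        ({w : Fin 2 → ℝ | |w 1| < 1}).indicator (fun w => ENNReal.ofReal (Real.exp (-(∑ i, w i ^ 2 / 2)))) p.2 := by
    funext p
    simp only [quadForm_one_eq_gaussian]
  have hA : Measurable fun p : Unit × (Fin 2 → ℝ) => ∑ i, p.2 i ^ 2 / 2 :=
    Finset.measurable_sum _ fun i _ => (((measurable_pi_apply i).comp measurable_snd).pow_const 2).div_const 2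
  have hF : Measurable fun p : Unit × (Fin 2 → ℝ) => ENNReal.ofReal (Real.exp (-(∑ i, p.2 i ^ 2 / 2))) :=
    ENNReal.measurable_ofReal.comp (Real.measurable_exp.comp hA.neg)
  have hKhat : MeasurableSet {p : Unit × (Fin 2 → ℝ) | p.2 ∈ {w : Fin 2 → ℝ | |w 1| < 1}} :=
    measurableSet_lt ((measurable_pi_apply 1).comp measurable_snd).abs measurable_const
  have hK1 : ∀ (_ : Unit) (w : Fin 2 → ℝ) (y : ℝ),
      update w 0 y ∈ {w : Fin 2 → ℝ | |w 1| < 1} ↔ w ∈ {w : Fin 2 → ℝ | |w 1| < 1} := by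
    intro _ w y
    simp only [mem_setOf_eq, update_of_ne (show (1 : Fin 2) ≠ 0 by decide)]
  have hgG : Measurable fun p : Unit × (Fin 2 → ℝ) =>
      ({w : Fin 2 → ℝ | |w 1| < 1}).indicator (fun w => ENNReal.ofReal (Real.exp (-(∑ i, w i ^ 2 / 2)))) p.2 :=
    measurable_fibreIndicator (fun _ : Unit => {w : Fin 2 → ℝ | |w 1| < 1}) hKhat
      (F := fun (_ : Unit) (w : Fin 2 → ℝ) => ENNReal.ofReal (Real.exp (-(∑ i, w i ^ 2 / 2)))) hF
  have hg : Measurable fun p : Unit × (Fin 2 → ℝ) =>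
      ({w : Fin 2 → ℝ | |w 1| < 1}).indicator (fun w => ENNReal.ofReal (Real.exp
        (-(1 / 2 * ((w - (0 : Fin 2 → ℝ)) ⬝ᵥ ((1 : Matrix (Fin 2) (Fin 2) ℝ) *ᵥ (w - 0))) + (0 : ℝ))))) p.2 := by
    rw [hdens]; exact hgG
  haveI : IsFiniteMeasure (((Measure.dirac ()).prod (volume : Measure (Fin 2 → ℝ))).withDensity
      fun p : Unit × (Fin 2 → ℝ) =>
        ({w : Fin 2 → ℝ | |w 1| < 1}).indicator (fun w => ENNReal.ofReal (Real.exp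
          (-(1 / 2 * ((w - (0 : Fin 2 → ℝ)) ⬝ᵥ ((1 : Matrix (Fin 2) (Fin 2) ℝ) *ᵥ (w - 0))) + (0 : ℝ))))) p.2) := by
    rw [hdens, withDensity_fibreIndicator_eq_restrict _ (fun _ : Unit => {w : Fin 2 → ℝ | |w 1| < 1}) hKhat
      (fun (_ : Unit) (w : Fin 2 → ℝ) => ENNReal.ofReal (Real.exp (-(∑ i, w i ^ 2 / 2))))]
    infer_instance
  have hU : Measurable fun p : Unit × (Fin 2 → ℝ) => |p.2 1| := ((measurable_pi_apply 1).comp measurable_snd).abs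
  have he : Real.exp 1 * 2 * ((2 : ℝ) / 3 - 1 / 2) < 1 := by nlinarith [Real.exp_one_lt_d9]
  have hq0 : 0 ≤ 2 * (Real.exp 1 * 2 * ((2 : ℝ) / 3 - 1 / 2) / (1 - Real.exp 1 * 2 * ((2 : ℝ) / 3 - 1 / 2))) :=
    mul_nonneg zero_le_two (div_nonneg (by positivity) (sub_nonneg.2 he.le))
  have hslab : Convex ℝ {w : Fin 2 → ℝ | |w 1| < 1} := by
    have hlin : IsLinearMap ℝ fun w : Fin 2 → ℝ => w 1 := ⟨fun _ _ => rfl, fun _ _ => rfl⟩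
    have hset : {w : Fin 2 → ℝ | |w 1| < 1} = {w : Fin 2 → ℝ | -1 < w 1} ∩ {w | w 1 < 1} := by
      ext w
      simp only [mem_setOf_eq, mem_inter_iff, abs_lt]
    rw [hset]
    exact (convex_halfSpace_gt hlin (-1)).inter (convex_halfSpace_lt hlin 1)
  refine slotAntiConcentration_restrict_of_projectedCentre_species (Measure.dirac ())
    (fun _ => {w : Fin 2 → ℝ | |w 1| < 1}) 1 Matrix.isSymm_one (γ := 1 / 2) (G := 0) (by norm_num)
    sup_sq_le_two_dot (fun _ => 0) (c := fun _ => 0) measurable_const (fun _ _ => 0) hg hU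
    MeasurableSet.univ {0} {0} (fun _ => 1 / 2) (fun _ => 0) (fun _ => 0) (fun _ => by norm_num) (fun _ => le_rfl)
    (fun _ _ => by simp) (fun _ => Ioo (-(1 / 2) : ℝ) (1 / 2)) (fun _ => Ioo (-(2 / 3) : ℝ) (2 / 3)) ?_ ?_ _
    (fun _ _ => hq0) ?_ ?_ (fun _ _ _ _ _ => by simp) one_pos (by norm_num) (by norm_num) one_pos (fun _ => hslab)
    ?_ ?_ ?_ ?_ ?_ ?_
  · -- hP: the support letter IS the species letter
    intro i hi
    rw [if_pos hi]
  · -- hE: the envelope letter IS the species-relaxed letter `θₑ + (1 − l₀)(θₑ + M₀) = ½ + ⅓·½ = ⅔`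
    intro i hi
    rw [if_pos hi]
    show Ioo (-(2 / 3) : ℝ) (2 / 3) = Ioo _ _
    simp only [Fintype.card_fin, Nat.cast_ofNat]
    norm_num
  · -- hodds: identify the density, then 38m §1 under the cut on 38l §2's Gaussian species at the letter (−½, ½)
    intro i hi C hC hCi
    rw [Finset.mem_singleton] at hi
    subst hi
    rw [hdens]
    exact condOdds_keptCuts ((Measure.dirac ()).prod volume) (fun _ : Unit => {w : Fin 2 → ℝ | |w 1| < 1}) hKhat
      (fun (_ : Unit) (w : Fin 2 → ℝ) => ENNReal.ofReal (Real.exp (-(∑ i, w i ^ 2 / 2)))) hK1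
      measurableSet_Ioo measurableSet_Ioo
      (fun C hC hCi => hodds_absLetter_of_partialSlopes (Measure.dirac ()) hA 0 (by norm_num) (by norm_num)
        (by norm_num) he (gaussianBlock_inwardSlopes_half 0).1 (gaussianBlock_inwardSlopes_half 0).2 C hC hCi)
      C hC hCi
  · -- the slot statistic reads no collar coordinate
    intro i hi z w y
    rw [Finset.mem_singleton] at hi
    subst hi
    show |update w 0 y 1| = |w 1|
    rw [update_of_ne (by decide)]
  · -- the dilation centre lies in the kept cut
    intro _
    show |(0 : Fin 2 → ℝ) 1| < 1
    simp
  · -- `P = 0` is `0`-Lipschitz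
    intro _ v _ v' _
    simp
  · -- hobt: the cross term about `c = m = 0` vanishes
    intro p _ _ _ _
    simp
  · -- hfar: `2·0 ≤ ½‖·‖`
    intro p _ _ _ _
    simp only [mul_zero]
    positivity
  · -- hcore: the core fibre `{|w₁| < 1}` is convex and contains the centre (38m §2 `hcore_of_starConvex`)
    have hl₀ : (0 : ℝ) ≤ 1 - 1 / ((Fintype.card (Fin 2) : ℝ) + 1) := by
      simp only [Fintype.card_fin, Nat.cast_ofNat]
      norm_num
    refine hcore_of_starConvex (fun _ => (0 : Fin 2 → ℝ)) (fun p : Unit × (Fin 2 → ℝ) => |p.2 1|) univ hl₀ ?_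
    intro p _ _ _
    show StarConvex ℝ (0 : Fin 2 → ℝ)
      {w : Fin 2 → ℝ | |w 1| < 1 ∧ ((p.1, w) : Unit × (Fin 2 → ℝ)) ∈ (univ : Set (Unit × (Fin 2 → ℝ)))}
    have hset : {w : Fin 2 → ℝ | |w 1| < 1 ∧ ((p.1, w) : Unit × (Fin 2 → ℝ)) ∈ (univ : Set (Unit × (Fin 2 → ℝ)))}
        = {w : Fin 2 → ℝ | |w 1| < 1} := by
      ext w
      simp only [mem_setOf_eq, mem_univ, and_true]
    rw [hset]
    exact hslab.starConvex (by simp)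
  · -- hRT: `U = |w₁|` is radially transversal with `κ₀ = 1` on `{½ ≤ U}`
    intro p h1 _ _ s hs _ _ _
    have h1' : 1 / 2 ≤ |p.2 1| := by have h := h1; norm_num at h; exact h
    simp only [zero_add, sub_zero, Pi.smul_apply, smul_eq_mul]
    rw [abs_mul, abs_of_nonneg (by linarith : (0 : ℝ) ≤ s)]
    nlinarith [mul_nonneg (show (0 : ℝ) ≤ s - 1 by linarith) (show (0 : ℝ) ≤ |p.2 1| - 1 / 2 by linarith)]

end Witness

end Summit.QuantumFields.YangMills.Theorems.N21CollarJunctionLetterSpecies
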